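import Mathlib
import Summits.NavierStokesRegularity.NavierStokesRegularity.Theorems.FilamentSkeletonRssClause13ModelPieceBand

/-!
# Clause 13-J/13-R, brick n3 LAYER C (NEGATIVE-BAND PIECE BY REFLECTION): the conjugate-kernel piece `P₋ = a∗Y − i·(b∗Y)` (profile in the
# band `𝔖′(z√q) ≤ −σ₀`) obeys the same estimate as `P₊ = a∗Y + i·(b∗Y)`

Route `FilamentSkeletonRss`, ∃-side clause 13 (`Clause13RNearStraightL` stmt-NavierStokesRegularity-23612; typing-agnostic); design
`filament-plan/DESIGN-28296-model-gluing-g16-v2-addendum.md` §A/§C (BAND piece, negative frequencies; task C4).  The model class is invariant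
under the reflection `τ ↦ 2c − τ`: with `Ỹ(u) = Y(2c−u)`, `w̃(u) = −w(2c−u)`, `β̃_i(u) = β_i(2c−u)` one has `(𝓛Y)(2c−u) = 𝓛̃Ỹ(u)`, all the norms
`‖𝓛Y‖₂, ‖Y‖₂, ‖(τ−c)Y‖₂` are preserved, the constants `Λ, b_i, L_i` are preserved, and for `a` even, `b` odd
`(a∗Y − i b∗Y)(2c−x) = (a∗Ỹ + i b∗Ỹ)(x)`.  Hence `model_piece_band_estimate` (p702355) applied to the reflected data gives
`model_piece_band_estimate_reflected`: the SAME bound for `‖a∗Y − i(b∗Y)‖₂²`, whose profile `χ_a − iχ_b` is the mirror image of `χ_a + iχ_b`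
(so it lives in the negative band when `χ_a + iχ_b` lives in the positive one).
* §1 `piece_reflect_even`, `piece_reflect_odd`, `smoothingPiece_reflect` (change of variables `y ↦ 2c − y`);
* §2 `model_piece_band_estimate_reflected`.
Lane ns-filament-19175-p1 g16; `--supports stmt-NavierStokesRegularity-23612 --as helper`.
HONEST FRAMING: bookkeeping about an explicit 1-D model operator attached to a HYPOTHETICAL filament skeleton on the NEGATIVE side of a MODEL route;
nothing here bears on Navier–Stokes regularity or blow-up.
-/

noncomputable section

open MeasureTheory Real Complex Filter Set
open scoped ComplexConjugate Topology
open Summit.NavierStokesRegularity.NavierStokesRegularity.Theorems.AnalyticStripLiaSymbol (liaSym)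

namespace Summit.NavierStokesRegularity.NavierStokesRegularity.Theorems.MatchedKernel
set_option linter.dupNamespace false

/-! ## §1 Reflection identities -/

/-- For an EVEN kernel: `∫a(x−y)Y(2c−y)dy = (a∗Y)(2c−x)`. [folklore] -/
theorem piece_reflect_even {a : ℝ → ℝ} (haev : ∀ t, a (-t) = a t) (Y : ℝ → ℂ) (c x : ℝ) :
    ∫ y : ℝ, ((a (x - y) : ℝ) : ℂ) * Y (2 * c - y) = ∫ y : ℝ, ((a (2 * c - x - y) : ℝ) : ℂ) * Y y := by
  rw [← integral_sub_left_eq_self (fun y => ((a (2 * c - x - y) : ℝ) : ℂ) * Y y) volume (2 * c)]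
  refine integral_congr_ae (ae_of_all _ fun y => ?_)
  beta_reduce
  rw [show 2 * c - x - (2 * c - y) = -(x - y) by ring, haev]

/-- For an ODD kernel: `∫b(x−y)Y(2c−y)dy = −(b∗Y)(2c−x)`. [folklore] -/
theorem piece_reflect_odd {b : ℝ → ℝ} (hbodd : ∀ t, b (-t) = -b t) (Y : ℝ → ℂ) (c x : ℝ) :
    ∫ y : ℝ, ((b (x - y) : ℝ) : ℂ) * Y (2 * c - y) = -∫ y : ℝ, ((b (2 * c - x - y) : ℝ) : ℂ) * Y y := by
  rw [← integral_neg, ← integral_sub_left_eq_self (fun y => -(((b (2 * c - x - y) : ℝ) : ℂ) * Y y)) volume (2 * c)]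
  refine integral_congr_ae (ae_of_all _ fun y => ?_)
  beta_reduce
  rw [show 2 * c - x - (2 * c - y) = -(x - y) by ring, hbodd]
  push_cast
  ring

/-- The smoothing kernel is even: `∫K_q(y−σ)Y(2c−σ)dσ = (K_q∗Y)(2c−y)`. [folklore] -/
theorem smoothingPiece_reflect (q : ℝ) (Y : ℝ → ℂ) (c y : ℝ) :
    ∫ σ : ℝ, ((((2 * q - (y - σ) ^ 2) * (((y - σ) ^ 2 + q) ^ (5 / 2 : ℝ))⁻¹ : ℝ)) : ℂ) * Y (2 * c - σ)
      = ∫ σ : ℝ, ((((2 * q - ((2 * c - y) - σ) ^ 2) * ((((2 * c - y) - σ) ^ 2 + q) ^ (5 / 2 : ℝ))⁻¹ : ℝ)) : ℂ) * Y σ := by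
  rw [← integral_sub_left_eq_self
    (fun σ => ((((2 * q - ((2 * c - y) - σ) ^ 2) * ((((2 * c - y) - σ) ^ 2 + q) ^ (5 / 2 : ℝ))⁻¹ : ℝ)) : ℂ) * Y σ) volume (2 * c)]
  refine integral_congr_ae (ae_of_all _ fun σ => ?_)
  beta_reduce
  rw [show 2 * c - y - (2 * c - σ) = -(y - σ) by ring, neg_sq]

/-! ## §2 The reflected band piece estimate -/

/-- **NEGATIVE-BAND PIECE ESTIMATE (by reflection).**  Hypotheses of `model_piece_band_estimate` (kernels `a, b` with profile `χ_a + iχ_b`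
in the band `σ₀ ≤ 𝔖′(z√q)`; `Y ∈ C¹_c`; `w, β_i` as there), and additionally `a` even, `b` odd.  Then the conjugate-kernel piece
`P₋ = a∗Y − i(b∗Y)` (profile `χ_a(−z) − iχ_b(−z)`... i.e. the mirror image, living in `𝔖′ ≤ −σ₀`) satisfies the same bound:
`G(σ₀/√q)∫‖P₋‖² ≤ (K·N(𝓛Y) + (Λ(K′₁+K) + (L₁+L₂)K₁ + (Λ+b₁+3b₂)K)·N(Y)) · √2(K·N((τ−c)Y) + K₁·N(Y))`.  Proof: apply
`model_piece_band_estimate` to `Ỹ(u) = Y(2c−u)`, `w̃(u) = −w(2c−u)`, `β̃_i(u) = β_i(2c−u)` and undo the reflection in every norm. [folklore] -/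
theorem model_piece_band_estimate_reflected {q G σ₀ : ℝ} (hq : 0 < q) (hG : 0 < G)
    {a a' b b' : ℝ → ℝ} (ha : ∀ t, HasDerivAt a (a' t) t) (ha'c : Continuous a') (hai : Integrable a) (ha'i : Integrable a')
    (ha1 : Integrable fun t => t * a t) (ha'1 : Integrable fun t => t * a' t) {Ma : ℝ} (haM : ∀ t, |a t| ≤ Ma)
    (hb : ∀ t, HasDerivAt b (b' t) t) (hb'c : Continuous b') (hbi : Integrable b) (hb'i : Integrable b')
    (hb1 : Integrable fun t => t * b t) (hb'1 : Integrable fun t => t * b' t) {Mb : ℝ} (hbM : ∀ t, |b t| ≤ Mb)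
    (haev : ∀ t, a (-t) = a t) (hbodd : ∀ t, b (-t) = -b t)
    {χa χb : ℝ → ℂ} (haχ : ∀ z : ℝ, ∫ t : ℝ, ((a t : ℝ) : ℂ) * cexp (I * z * t) = χa z)
    (hbχ : ∀ z : ℝ, ∫ t : ℝ, ((b t : ℝ) : ℂ) * cexp (I * z * t) = χb z)
    (hband : ∀ z : ℝ, χa z + I * χb z ≠ 0 → σ₀ ≤ deriv liaSym (z * √q))
    {Y : ℝ → ℂ} (hY : ContDiff ℝ 1 Y) (hYs : HasCompactSupport Y) (c : ℝ)
    {w : ℝ → ℝ} (hw : Differentiable ℝ w) {Λ : ℝ} (hΛ : ∀ t, |deriv w t| ≤ Λ) (hwc : w c = 0)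
    {β₁ β₂ : ℝ → ℂ} (hβ₁c : Continuous β₁) (hβ₂c : Continuous β₂) {b₁ b₂ L₁ L₂ : ℝ}
    (hb₁ : ∀ τ, ‖β₁ τ‖ ≤ b₁) (hb₂ : ∀ τ, ‖β₂ τ‖ ≤ b₂) (hL₁ : ∀ x y, ‖β₁ y - β₁ x‖ ≤ L₁ * |y - x|)
    (hL₂ : ∀ x y, ‖β₂ y - β₂ x‖ ≤ L₂ * |y - x|) :
    G * (σ₀ / √q) * ∫ x : ℝ, ‖((∫ y : ℝ, ((a (x - y) : ℝ) : ℂ) * Y y) - I * ∫ y : ℝ, ((b (x - y) : ℝ) : ℂ) * Y y)‖ ^ 2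
      ≤ (((∫ t, |a t|) + (∫ t, |b t|)) * (∫ y : ℝ, ‖I * (G : ℂ) * ((2 / q : ℂ) * Y y
              - ∫ σ : ℝ, ((((2 * q - (y - σ) ^ 2) * (((y - σ) ^ 2 + q) ^ (5 / 2 : ℝ))⁻¹ : ℝ)) : ℂ) * Y σ)
            - ((w y : ℝ) : ℂ) * deriv Y y + β₁ y * Y y + β₂ y * conj (Y y)‖ ^ 2) ^ (1 / 2 : ℝ)
          + (Λ * (((∫ t, |t| * |a' t|) + (∫ t, |t| * |b' t|)) + ((∫ t, |a t|) + (∫ t, |b t|))) + (L₁ + L₂) * ((∫ t, |t| * |a t|) + (∫ t, |t| * |b t|))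
              + (Λ + b₁ + 3 * b₂) * ((∫ t, |a t|) + (∫ t, |b t|))) * (∫ y : ℝ, ‖Y y‖ ^ 2) ^ (1 / 2 : ℝ))
        * (Real.sqrt 2 * (((∫ t, |a t|) + (∫ t, |b t|)) * (∫ y : ℝ, ‖(((y - c : ℝ) : ℂ)) * Y y‖ ^ 2) ^ (1 / 2 : ℝ)
          + ((∫ t, |t| * |a t|) + (∫ t, |t| * |b t|)) * (∫ y : ℝ, ‖Y y‖ ^ 2) ^ (1 / 2 : ℝ))) := by
  -- the reflected data
  have hYr : ContDiff ℝ 1 (fun u : ℝ => Y (2 * c - u)) := hY.comp (contDiff_const.sub contDiff_id)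
  have hYrs : HasCompactSupport (fun u : ℝ => Y (2 * c - u)) := hYs.comp_homeomorph (Homeomorph.subLeft (2 * c))
  have hwr : Differentiable ℝ (fun u : ℝ => -w (2 * c - u)) := (hw.comp (differentiable_id.const_sub (2 * c))).neg
  have hΛr : ∀ t, |deriv (fun u : ℝ => -w (2 * c - u)) t| ≤ Λ := fun t => by
    rw [deriv.fun_neg, deriv_comp_const_sub, neg_neg]; exact hΛ _
  have hwrc : (fun u : ℝ => -w (2 * c - u)) c = 0 := by
    show -w (2 * c - c) = 0
    rw [show 2 * c - c = c by ring, hwc, neg_zero]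
  have hβ₁r : Continuous fun u : ℝ => β₁ (2 * c - u) := hβ₁c.comp (continuous_const.sub continuous_id)
  have hβ₂r : Continuous fun u : ℝ => β₂ (2 * c - u) := hβ₂c.comp (continuous_const.sub continuous_id)
  have hb₁r : ∀ τ, ‖β₁ (2 * c - τ)‖ ≤ b₁ := fun τ => hb₁ _
  have hb₂r : ∀ τ, ‖β₂ (2 * c - τ)‖ ≤ b₂ := fun τ => hb₂ _
  have hL₁r : ∀ x y, ‖β₁ (2 * c - y) - β₁ (2 * c - x)‖ ≤ L₁ * |y - x| := fun x y => by
    have h := hL₁ (2 * c - x) (2 * c - y)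
    rwa [show 2 * c - y - (2 * c - x) = -(y - x) by ring, abs_neg] at h
  have hL₂r : ∀ x y, ‖β₂ (2 * c - y) - β₂ (2 * c - x)‖ ≤ L₂ * |y - x| := fun x y => by
    have h := hL₂ (2 * c - x) (2 * c - y)
    rwa [show 2 * c - y - (2 * c - x) = -(y - x) by ring, abs_neg] at h
  -- the positive-band estimate for the reflected data
  have h := model_piece_band_estimate hq hG ha ha'c hai ha'i ha1 ha'1 haM hb hb'c hbi hb'i hb1 hb'1 hbM haχ hbχ hband
    hYr hYrs c hwr hΛr hwrc hβ₁r hβ₂r hb₁r hb₂r hL₁r hL₂r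
  -- undo the reflection in every norm
  have hLHS : (∫ x : ℝ, ‖((∫ y : ℝ, ((a (x - y) : ℝ) : ℂ) * Y (2 * c - y)) + I * ∫ y : ℝ, ((b (x - y) : ℝ) : ℂ) * Y (2 * c - y))‖ ^ 2)
      = ∫ x : ℝ, ‖((∫ y : ℝ, ((a (x - y) : ℝ) : ℂ) * Y y) - I * ∫ y : ℝ, ((b (x - y) : ℝ) : ℂ) * Y y)‖ ^ 2 := by
    rw [← integral_sub_left_eq_self (fun s : ℝ => ‖((∫ y : ℝ, ((a (s - y) : ℝ) : ℂ) * Y y) - I * ∫ y : ℝ, ((b (s - y) : ℝ) : ℂ) * Y y)‖ ^ 2) volume (2 * c)]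
    refine integral_congr_ae (ae_of_all _ fun x => ?_)
    beta_reduce
    rw [piece_reflect_even haev Y c x, piece_reflect_odd hbodd Y c x, mul_neg, ← sub_eq_add_neg]
  have hNY : (∫ y : ℝ, ‖Y (2 * c - y)‖ ^ 2) = ∫ y : ℝ, ‖Y y‖ ^ 2 :=
    integral_sub_left_eq_self (fun y => ‖Y y‖ ^ 2) volume (2 * c)
  have hNW : (∫ y : ℝ, ‖(((y - c : ℝ) : ℂ)) * Y (2 * c - y)‖ ^ 2) = ∫ y : ℝ, ‖(((y - c : ℝ) : ℂ)) * Y y‖ ^ 2 := by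
    rw [← integral_sub_left_eq_self (fun s : ℝ => ‖(((s - c : ℝ) : ℂ)) * Y s‖ ^ 2) volume (2 * c)]
    refine integral_congr_ae (ae_of_all _ fun y => ?_)
    beta_reduce
    simp only [norm_mul, Complex.norm_real, Real.norm_eq_abs]
    rw [show 2 * c - y - c = -(y - c) by ring, abs_neg]
  have hNL : (∫ y : ℝ, ‖I * (G : ℂ) * ((2 / q : ℂ) * Y (2 * c - y)
          - ∫ σ : ℝ, ((((2 * q - (y - σ) ^ 2) * (((y - σ) ^ 2 + q) ^ (5 / 2 : ℝ))⁻¹ : ℝ)) : ℂ) * Y (2 * c - σ))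
        - ((-w (2 * c - y) : ℝ) : ℂ) * deriv (fun u : ℝ => Y (2 * c - u)) y
        + β₁ (2 * c - y) * Y (2 * c - y) + β₂ (2 * c - y) * conj (Y (2 * c - y))‖ ^ 2)
      = ∫ y : ℝ, ‖I * (G : ℂ) * ((2 / q : ℂ) * Y y
          - ∫ σ : ℝ, ((((2 * q - (y - σ) ^ 2) * (((y - σ) ^ 2 + q) ^ (5 / 2 : ℝ))⁻¹ : ℝ)) : ℂ) * Y σ)
        - ((w y : ℝ) : ℂ) * deriv Y y + β₁ y * Y y + β₂ y * conj (Y y)‖ ^ 2 := by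
    rw [← integral_sub_left_eq_self (fun s : ℝ => ‖I * (G : ℂ) * ((2 / q : ℂ) * Y s
          - ∫ σ : ℝ, ((((2 * q - (s - σ) ^ 2) * (((s - σ) ^ 2 + q) ^ (5 / 2 : ℝ))⁻¹ : ℝ)) : ℂ) * Y σ)
        - ((w s : ℝ) : ℂ) * deriv Y s + β₁ s * Y s + β₂ s * conj (Y s)‖ ^ 2) volume (2 * c)]
    refine integral_congr_ae (ae_of_all _ fun y => ?_)
    beta_reduce
    rw [smoothingPiece_reflect q Y c y, deriv_comp_const_sub Y (2 * c) y,
      show ((-w (2 * c - y) : ℝ) : ℂ) * -deriv Y (2 * c - y) = ((w (2 * c - y) : ℝ) : ℂ) * deriv Y (2 * c - y) by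
        push_cast; ring]
  rw [hLHS, hNY, hNW, hNL] at h
  exact h

end Summit.NavierStokesRegularity.NavierStokesRegularity.Theorems.MatchedKernel

end
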